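import Summits.HubbardSuperconductivity.HubbardSuperconductivity.Theses.FunctionFieldCertificate
import Summits.HubbardSuperconductivity.HubbardSuperconductivity.Theorems.FunctionFieldCertificateMesoscopicPairOrderBoxTransferCore
import HarnessLib

/-!
# Crux `MesoscopicPairOrder` (stmt-HubbardSuperconductivity-7331) — the WINDOW TRANSFER, file 2 of 2:
# SHARP box order ⇒ the crux

Supports item `stmt-HubbardSuperconductivity-7331` (route `FunctionFieldCertificate`, pole-free crux; open physics,
not settled here). The crux-idea card `window-stationarity-box-transfer` (ideator 3) proposed to replace the crux
by BOX ORDER: every density matrix `ρ` on the Fock space of any torus `L ≥ 2R + 2` that is (S) stationary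
(`0 ≤ Re Tr ρ Qᴴ[H_L, Q]` for particle-number-preserving `Q`), (T) translation consistent
(`Tr ρ A = Tr ρ τ_u(A)`) and (D) has MEAN window density within `η` of `n = 1 - δ`, has average `R'`-sub-window
`d`-wave order `m · #anchors ≤ Σ_{u ∈ anchors} Re Tr ρ B'_uᴴ B'_u / R'⁴` (`B'_u = Σ_{w ∈ [0,R')²} P_{u+w}`), for an
unbounded family of measurement scales `R'` with one margin `m`.

AS TYPED THAT STATEMENT IS FALSE at every `(U, δ, m, η)`: the phase-separated mixture
`ρ = (n/2)|full⟩⟨full| + (1 - n/2)|vac⟩⟨vac|` of the filled lattice and the vacuum satisfies (S) for EVERY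
`N̂`-commuting `Q` (both components are alone in their particle-number sectors), (T) for every `A`, and (D)
exactly, while its sub-window pair weight is `O(R'²)` (the pairs removed from `|full⟩` by `P_x`, `P_y` are
orthogonal unless `x, y` are within one step), not `≥ m R'⁴` — see the companion refutation file
`Theorems/FunctionFieldCertificateMesoscopicPairOrderBoxOrderRefutation.lean`. The mean-density constraint (D)
admits convex combinations ACROSS particle numbers; what a ground state actually supplies is a SHARP particle
number. This file lands the repaired, non-vacuous transfer:

* `mesoscopicPairOrder_of_sharpBoxOrder` — SHARP BOX ORDER ⇒ `MesoscopicPairOrder`. Sharp box order at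
  `(U, δ, m; R, R', r)`: on every EVEN torus `L ≥ 2R + 2`, every `ρ` with `ρ ⪰ 0`, `Tr ρ = 1`, `[ρ, N̂] = 0`,
  `N̂ ρ = N_L ρ` (`N_L = 2⌊(1-δ)L²/2⌋`: the state lives in ONE particle-number sector), (S) for every `N̂`-commuting
  `Q`, (T) for every `A, u`, and the exact window density `Tr ρ N_{[0,R)²} = R² N_L / L²`, has
  `m · #anchors ≤ Σ_{u ∈ anchors} Re Tr ρ B'_uᴴ B'_u / R'⁴`. If at some `(U, δ)` this holds with one `m > 0` for
  scales `R' ≥ R₀` (every `R₀`; `R' + 2r + 3 ≤ R`), then the crux holds with the same `(U, δ, m)` at the scales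
  `R'` (threshold `L ≥ 2R + 2`). Proof: the translation average `ρ̄ = L⁻² Σ_v |T_v ψ⟩⟨T_v ψ|` of a normalised
  sector ground state satisfies every granted constraint (file 1) and each of its sub-window weights is
  `R'² T_{R'}(ψ)/L²` (`translationAverageDictionary`); the anchor set contains `(r+1, r+1)`.
* `mesoscopicPairOrderOfSharpBoxOrder` — registered form.

Reading. With the sharp sector constraint the admissible `ρ` are (by (S) tested on `Q = |χ⟩⟨ξ|` inside the
sector) exactly the translation-invariant mixtures of GLOBAL `N_L`-particle ground states, so sharp box order at
`(R, R')` is the crux's own every-scale body at scale `R'` with the explicit threshold `L ≥ 2R + 2` (and `R` is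
free): the window-stationarity line, repaired, is a REFORMULATION of the crux with an `L`-uniform threshold, not a
weakening. Any genuinely box-local version must replace "sharp `N`" by window-local information a sharp-`N`
ground state provably supplies; the mean density alone is not enough (refutation file), and no universal bound on
the window particle-number fluctuations of an interacting ground state is available (phase separation).

Sources: Bratteli–Kishimoto–Robinson, CMP 64 (1978) 41 (ground states as locally stable states);
Pironio–Navascués–Acín, SIAM J. Optim. 20 (2010) 2157 §2 (first-order / KKT state constraints); Tasaki (2020)
§2.1, §4.1. All folklore; no definition is introduced.
-/

noncomputable section

-- the summit namespace `Summit.HubbardSuperconductivity.HubbardSuperconductivity.…` repeats the problem name by design (D-0017)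
set_option linter.dupNamespace false

namespace Summit.HubbardSuperconductivity.HubbardSuperconductivity.Theorems.FunctionFieldCertificate

open Matrix Finset Filter
open Literature.Probability.LatticeModels Literature.MathematicalPhysics.QuantumLattice
open Summit.HubbardSuperconductivity.HubbardSuperconductivity.Theses.FunctionFieldCertificate
open scoped ComplexOrder

/-- **WINDOW TRANSFER: SHARP BOX ORDER ⇒ `MesoscopicPairOrder`.** Suppose that at some `U > 0`,
`δ ∈ (0, 1/2)` there is a margin `m > 0` such that for every `R₀` there are a measurement scale `R' ≥ R₀`,
`0 < R'`, a collar `r` and a window `R` with `R' + 2r + 3 ≤ R` for which SHARP BOX ORDER holds: on every EVEN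
torus of side `L ≥ 2R + 2`, every matrix `ρ` with `ρ ⪰ 0`, `Tr ρ = 1`, `[ρ, N̂] = 0`, `N̂ ρ = N_L ρ`
(`N_L = 2⌊(1-δ)L²/2⌋`), (S) `0 ≤ Re Tr ρ Qᴴ (H_L Q - Q H_L)` for every `Q` commuting with `N̂`
(`H_L = hubbardTorus 2 L 1 U`), (T) `Tr ρ A = Tr ρ τ_u(A)` for every matrix `A` and translation `u`, and the exact
window density `Tr ρ N_{[0,R)²} = L⁻² · R² · N_L`, has average sub-window `d`-wave order
`m · #anchors ≤ Σ_{u ∈ anchors} Re Tr ρ B'_uᴴ B'_u / R'⁴` over the anchors `u` with `r + 1 ≤ u_i`,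
`u_i + R' + r + 1 < R` (`B'_u = Σ_{w ∈ [0,R')²} P_{u+w}`). Then `MesoscopicPairOrder` holds with the same
`(U, δ, m)`, at the scales `R'`, threshold `L ≥ 2R + 2`. Proof: the translation average
`ρ̄ = L⁻² Σ_v |T_v ψ⟩⟨T_v ψ|` of a normalised sector ground state is a mixture of sector ground states
(`T_v H T_v⁻¹ = H`) in the single sector `N_L`, satisfies (S), (T) and the density identity (file 1), and every
one of its sub-window weights equals `R'² T_{R'}(ψ)/L²`; the anchor set contains `(r+1, r+1)`. Card
window-stationarity-box-transfer (`BoxOrderGivesCrux`), repaired. [folklore] -/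
theorem mesoscopicPairOrder_of_sharpBoxOrder
    (h : ∃ U : ℝ, 0 < U ∧ ∃ δ ∈ Set.Ioo (0:ℝ) (1 / 2), ∃ m : ℝ, 0 < m ∧
      ∀ R₀ : ℕ, ∃ R R' r : ℕ, R₀ ≤ R' ∧ 0 < R' ∧ R' + 2 * r + 3 ≤ R ∧
        ∀ (L : ℕ) [NeZero L], 2 * R + 2 ≤ L → Even L →
          ∀ ρ : Matrix (Finset (Orb (FermionTorus 2 L))) (Finset (Orb (FermionTorus 2 L))) ℂ,
            ρ.PosSemidef → ρ.trace = 1 → Commute ρ totalNumberOp →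
            totalNumberOp * ρ = ((2 * ⌊(1 - δ) * (L : ℝ) ^ 2 / 2⌋₊ : ℕ) : ℂ) • ρ →
            (∀ Q : Matrix (Finset (Orb (FermionTorus 2 L))) (Finset (Orb (FermionTorus 2 L))) ℂ,
              Commute Q totalNumberOp →
                0 ≤ ((ρ * (Qᴴ * (hubbardTorus 2 L 1 U * Q - Q * hubbardTorus 2 L 1 U))).trace).re) →
            (∀ (A : Matrix (Finset (Orb (FermionTorus 2 L))) (Finset (Orb (FermionTorus 2 L))) ℂ)
              (u : TorusSite 2 L), (ρ * A).trace = (ρ * relabel (Orb.translate u) A).trace) →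
            (ρ * (∑ u : Fin 2 → Fin R, ∑ σ : Fin 2,
                numberOp (FermionTorus.ofTorusSite (fun i => ((u i : ℕ) : ZMod L))) σ)).trace =
              ((((L : ℝ) ^ 2)⁻¹ : ℝ) : ℂ) * ((R : ℂ) ^ 2 * ((2 * ⌊(1 - δ) * (L : ℝ) ^ 2 / 2⌋₊ : ℕ) : ℂ)) →
            m * (((Finset.univ.filter fun u : TorusSite 2 L =>
                ∀ i, r + 1 ≤ (u i).val ∧ (u i).val + R' + r + 1 < R)).card : ℝ) ≤
              ∑ u ∈ (Finset.univ.filter fun u : TorusSite 2 L =>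
                  ∀ i, r + 1 ≤ (u i).val ∧ (u i).val + R' + r + 1 < R),
                ((ρ * ((∑ w : Fin 2 → Fin R', localPair dWaveFormFactor L (u + fun i => ((w i : ℕ) : ZMod L)))ᴴ *
                  (∑ w : Fin 2 → Fin R', localPair dWaveFormFactor L (u + fun i => ((w i : ℕ) : ZMod L))))).trace).re /
                  (R' : ℝ) ^ 4) :
    MesoscopicPairOrder := by
  obtain ⟨U, hU, δ, hδ, m, hm, hbox⟩ := h
  refine ⟨U, hU, δ, hδ, m, hm, fun R₀ => ?_⟩
  obtain ⟨R, R', r, hR₀, hR', hRR, hBO⟩ := hbox R₀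
  refine ⟨R', hR₀, 2 * R + 2, ?_⟩
  intro L _ hL hE ψ hψ hgs
  have hL1 : 2 * R + 2 ≤ L := hL
  have hLpos : (0 : ℝ) < L := Nat.cast_pos.2 (Nat.pos_of_ne_zero (NeZero.ne L))
  have hL2 : (0 : ℝ) < (L : ℝ) ^ 2 := by positivity
  have hR'pos : (0 : ℝ) < R' := Nat.cast_pos.2 hR'
  have h2R' : 2 * R' ≤ L := by omega
  -- data of the ground state and its translates
  set N : ℕ := ⌊(1 - δ) * (L : ℝ) ^ 2 / 2⌋₊ with hNdef
  have hNpart : IsNParticle (2 * N) ψ := ((mem_szSector_iff _ _ _).1 hgs.1).1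
  have hgsv : ∀ v : TorusSite 2 L,
      IsGroundStateInSector (hubbardTorus 2 L 1 U) (2 * N) 0 ((fockTranslate v).val *ᵥ ψ) :=
    fun v => hgs.fockTranslate_mulVec v (relabel_translate_hubbardTorus v 1 U)
  have hNv : ∀ v : TorusSite 2 L, IsNParticle (2 * N) ((fockTranslate v).val *ᵥ ψ) :=
    fun v => hNpart.fockRelabel_mulVec (Orb.translate v)
  -- the translation average `ρ̄ = c • Σ_v |T_v ψ⟩⟨T_v ψ|`, `c = 1/L²`
  set c : ℝ := ((L : ℝ) ^ 2)⁻¹ with hc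
  have hcpos : 0 < c := by positivity
  set ρ : Matrix (Finset (Orb (FermionTorus 2 L))) (Finset (Orb (FermionTorus 2 L))) ℂ :=
    (c : ℂ) • ∑ v : TorusSite 2 L,
      vecMulVec ((fockTranslate v).val *ᵥ ψ) (star ((fockTranslate v).val *ᵥ ψ)) with hρ
  have htr : ∀ M : Matrix (Finset (Orb (FermionTorus 2 L))) (Finset (Orb (FermionTorus 2 L))) ℂ,
      (ρ * M).trace = (c : ℂ) * ∑ v : TorusSite 2 L,
        star ((fockTranslate v).val *ᵥ ψ) ⬝ᵥ M *ᵥ ((fockTranslate v).val *ᵥ ψ) := by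
    intro M
    rw [hρ, smul_mul_assoc, trace_smul, Finset.sum_mul, trace_sum, smul_eq_mul]
    congr 1
    exact Finset.sum_congr rfl fun v _ => trace_proj_mul _ M
  -- the constraints
  have hpsd : ρ.PosSemidef :=
    (posSemidef_sum _ fun v _ => proj_posSemidef _).smul (Complex.zero_le_real.2 hcpos.le)
  have htr1 : ρ.trace = 1 := by
    have h := htr 1
    rw [mul_one] at h
    rw [h]
    simp_rw [one_mulVec, star_fockRelabel_mulVec_dotProduct, hψ]
    rw [Finset.sum_const, Finset.card_univ, Fintype.card_fun, ZMod.card, Fintype.card_fin, nsmul_eq_mul,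
      mul_one, hc]
    have hLc : (L : ℂ) ≠ 0 := Nat.cast_ne_zero.2 (NeZero.ne L)
    push_cast
    exact inv_mul_cancel₀ (pow_ne_zero 2 hLc)
  have hcomm : Commute ρ totalNumberOp :=
    Commute.smul_left (Commute.sum_left _ _ _ fun v _ => commute_proj_totalNumberOp (hNv v)) _
  have hS : ∀ Q : Matrix (Finset (Orb (FermionTorus 2 L))) (Finset (Orb (FermionTorus 2 L))) ℂ,
      Commute Q totalNumberOp →
        0 ≤ ((ρ * (Qᴴ * (hubbardTorus 2 L 1 U * Q - Q * hubbardTorus 2 L 1 U))).trace).re := by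
    intro Q hQ
    rw [htr, Complex.re_ofReal_mul, Complex.re_sum]
    refine mul_nonneg hcpos.le (Finset.sum_nonneg fun v _ => ?_)
    have h := stationarity_trace_of_ground U N (hgsv v) Q hQ
    rwa [trace_proj_mul] at h
  have hT : ∀ (A : Matrix (Finset (Orb (FermionTorus 2 L))) (Finset (Orb (FermionTorus 2 L))) ℂ)
      (u : TorusSite 2 L), (ρ * A).trace = (ρ * relabel (Orb.translate u) A).trace := by
    intro A u
    rw [htr, htr, sum_expect_translate_relabel]
  have hNV : ∀ v : TorusSite 2 L,
      (totalNumberOp : Matrix (Finset (Orb (FermionTorus 2 L))) _ ℂ) *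
          vecMulVec ((fockTranslate v).val *ᵥ ψ) (star ((fockTranslate v).val *ᵥ ψ)) =
        ((2 * N : ℕ) : ℂ) • vecMulVec ((fockTranslate v).val *ᵥ ψ) (star ((fockTranslate v).val *ᵥ ψ)) := by
    intro v
    rw [mul_vecMulVec, totalNumberOp_eq_totalNumber, (LiebTwo.isNParticle_iff_totalNumber _ _).1 (hNv v),
      smul_vecMulVec]
  have hNrho : (totalNumberOp : Matrix (Finset (Orb (FermionTorus 2 L))) _ ℂ) * ρ = ((2 * N : ℕ) : ℂ) • ρ := by
    rw [hρ, mul_smul_comm, Finset.mul_sum]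
    simp_rw [hNV]
    rw [← Finset.smul_sum]
    exact smul_comm _ _ _
  have hDexact : (ρ * (∑ u : Fin 2 → Fin R, ∑ σ : Fin 2,
      numberOp (FermionTorus.ofTorusSite (fun i => ((u i : ℕ) : ZMod L))) σ)).trace =
      (c : ℂ) * ((R : ℂ) ^ 2 * ((2 * N : ℕ) : ℂ)) := by
    rw [htr]
    congr 1
    have hterm : ∀ v : TorusSite 2 L,
        star ((fockTranslate v).val *ᵥ ψ) ⬝ᵥ (∑ u : Fin 2 → Fin R, ∑ σ : Fin 2,
          numberOp (FermionTorus.ofTorusSite (fun i => ((u i : ℕ) : ZMod L))) σ) *ᵥ ((fockTranslate v).val *ᵥ ψ) =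
        ∑ u : Fin 2 → Fin R, ∑ σ : Fin 2, star ((fockTranslate v).val *ᵥ ψ) ⬝ᵥ
          numberOp (FermionTorus.ofTorusSite (fun i => ((u i : ℕ) : ZMod L))) σ *ᵥ ((fockTranslate v).val *ᵥ ψ) := by
      intro v
      rw [Matrix.sum_mulVec, dotProduct_sum]
      refine Finset.sum_congr rfl fun u _ => ?_
      rw [Matrix.sum_mulVec, dotProduct_sum]
    simp_rw [hterm]
    rw [Finset.sum_comm]
    have hinner : ∀ u : Fin 2 → Fin R,
        ∑ v : TorusSite 2 L, ∑ σ : Fin 2, star ((fockTranslate v).val *ᵥ ψ) ⬝ᵥ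
          numberOp (FermionTorus.ofTorusSite (fun i => ((u i : ℕ) : ZMod L))) σ *ᵥ ((fockTranslate v).val *ᵥ ψ) =
        ((2 * N : ℕ) : ℂ) := by
      intro u
      rw [Finset.sum_comm, sum_sum_expect_translate_numberOp hNpart, hψ, mul_one]
    simp_rw [hinner]
    rw [Finset.sum_const, Finset.card_univ, Fintype.card_fun, Fintype.card_fin, Fintype.card_fin,
      nsmul_eq_mul, Nat.cast_pow]
  -- BOX ORDER for `ρ̄`
  have hconcl := hBO L hL1 hE ρ hpsd htr1 hcomm hNrho hS hT hDexact
  -- every sub-window term equals `c R'² T_{R'}(ψ) / R'⁴`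
  set T : ℝ := ∑ x : TorusSite 2 L, ∑ y : TorusSite 2 L,
      (∏ i : Fin 2, max 0 (1 - |(((y i - x i).valMinAbs : ℤ) : ℝ)| / (R' : ℝ))) *
        (star (localPair dWaveFormFactor L x *ᵥ ψ) ⬝ᵥ (localPair dWaveFormFactor L y *ᵥ ψ)).re with hTdef
  set A : Finset (TorusSite 2 L) := Finset.univ.filter fun u : TorusSite 2 L =>
      ∀ i, r + 1 ≤ (u i).val ∧ (u i).val + R' + r + 1 < R with hA
  have hterm : ∀ u : TorusSite 2 L,
      ((ρ * ((∑ w : Fin 2 → Fin R', localPair dWaveFormFactor L (u + fun i => ((w i : ℕ) : ZMod L)))ᴴ *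
        (∑ w : Fin 2 → Fin R', localPair dWaveFormFactor L (u + fun i => ((w i : ℕ) : ZMod L))))).trace).re =
        c * ((R' : ℝ) ^ 2 * T) := by
    intro u
    rw [htr, Complex.re_ofReal_mul, Complex.re_sum, sum_expect_translate_block R' hR' h2R' ψ u]
  have hsum : ∑ u ∈ A, ((ρ * ((∑ w : Fin 2 → Fin R', localPair dWaveFormFactor L (u + fun i => ((w i : ℕ) : ZMod L)))ᴴ *
      (∑ w : Fin 2 → Fin R', localPair dWaveFormFactor L (u + fun i => ((w i : ℕ) : ZMod L))))).trace).re /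
        (R' : ℝ) ^ 4 = (A.card : ℝ) * (c * ((R' : ℝ) ^ 2 * T) / (R' : ℝ) ^ 4) := by
    rw [← nsmul_eq_mul, ← Finset.sum_const]
    exact Finset.sum_congr rfl fun u _ => by rw [hterm u]
  rw [hsum] at hconcl
  -- the anchor set is nonempty: it contains `(r+1, r+1)`
  have hcard : 0 < A.card := by
    refine Finset.card_pos.2 ⟨fun _ => ((r + 1 : ℕ) : ZMod L), ?_⟩
    simp only [hA, Finset.mem_filter, Finset.mem_univ, true_and]
    intro i
    rw [ZMod.val_natCast_of_lt (by omega : r + 1 < L)]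
    omega
  have hcardR : (0 : ℝ) < A.card := Nat.cast_pos.2 hcard
  -- `m ≤ c R'² T / R'⁴`, i.e. `m R'² L² ≤ T`
  have hmX : m ≤ c * ((R' : ℝ) ^ 2 * T) / (R' : ℝ) ^ 4 := le_of_mul_le_mul_left (by linarith [hconcl]) hcardR
  rw [le_div_iff₀ hL2]
  rw [le_div_iff₀ (by positivity), hc] at hmX
  have hkey : m * (R' : ℝ) ^ 4 * (L : ℝ) ^ 2 ≤ (R' : ℝ) ^ 2 * T := by
    have h1 := mul_le_mul_of_nonneg_right hmX hL2.le
    have h2 : ((L : ℝ) ^ 2)⁻¹ * ((R' : ℝ) ^ 2 * T) * (L : ℝ) ^ 2 = (R' : ℝ) ^ 2 * T := by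
      field_simp
    linarith [h1, h2.le, h2.ge]
  have h3 : (R' : ℝ) ^ 2 * (m * (R' : ℝ) ^ 2 * (L : ℝ) ^ 2) ≤ (R' : ℝ) ^ 2 * T := by
    calc (R' : ℝ) ^ 2 * (m * (R' : ℝ) ^ 2 * (L : ℝ) ^ 2) = m * (R' : ℝ) ^ 4 * (L : ℝ) ^ 2 := by ring
      _ ≤ (R' : ℝ) ^ 2 * T := hkey
  exact le_of_mul_le_mul_left h3 (by positivity)

/-- **Registered form of the sharp window transfer** (sub-goal `mesoscopicPairOrderOfSharpBoxOrder` of crux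
stmt-HubbardSuperconductivity-7331, line `Sketch`; verbatim `mesoscopicPairOrder_of_sharpBoxOrder`). [folklore] -/
theorem mesoscopicPairOrderOfSharpBoxOrder : (∃ U : ℝ, 0 < U ∧ ∃ δ ∈ Set.Ioo (0:ℝ) (1 / 2), ∃ m : ℝ, 0 < m ∧ ∀ R₀ : ℕ, ∃ R R' r : ℕ, R₀ ≤ R' ∧ 0 < R' ∧ R' + 2 * r + 3 ≤ R ∧ ∀ (L : ℕ) [NeZero L], 2 * R + 2 ≤ L → Even L → ∀ ρ : Matrix (Finset (Orb (FermionTorus 2 L))) (Finset (Orb (FermionTorus 2 L))) ℂ, ρ.PosSemidef → ρ.trace = 1 → Commute ρ totalNumberOp → totalNumberOp * ρ = ((2 * ⌊(1 - δ) * (L : ℝ) ^ 2 / 2⌋₊ : ℕ) : ℂ) • ρ → (∀ Q : Matrix (Finset (Orb (FermionTorus 2 L))) (Finset (Orb (FermionTorus 2 L))) ℂ, Commute Q totalNumberOp → 0 ≤ ((ρ * (Qᴴ * (hubbardTorus 2 L 1 U * Q - Q * hubbardTorus 2 L 1 U))).trace).re) → (∀ (A : Matrix (Finset (Orb (FermionTorus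 2 L))) (Finset (Orb (FermionTorus 2 L))) ℂ) (u : TorusSite 2 L), (ρ * A).trace = (ρ * relabel (Orb.translate u) A).trace) → (ρ * (∑ u : Fin 2 → Fin R, ∑ σ : Fin 2, numberOp (FermionTorus.ofTorusSite (fun i => ((u i : ℕ) : ZMod L))) σ)).trace = ((((L : ℝ) ^ 2)⁻¹ : ℝ) : ℂ) * ((R : ℂ) ^ 2 * ((2 * ⌊(1 - δ) * (L : ℝ) ^ 2 / 2⌋₊ : ℕ) : ℂ)) → m * (((Finset.univ.filter fun u : TorusSite 2 L => ∀ i, r + 1 ≤ (u i).val ∧ (u i).val + R' + r + 1 < R)).card : ℝ) ≤ ∑ u ∈ (Finset.univ.filter fun u : TorusSite 2 L => ∀ i, r + 1 ≤ (u i).val ∧ (u i).val + R' + r + 1 < R), ((ρ * ((∑ w : Fin 2 → Fin R', localPair dWaveFormFactor L (u + fun i => ((w i : ℕ) : ZMod L)))ᴴ * (∑ w : Fin 2 → Fin R', localPair dWaveFormFactor L (u + fun i => ((w i : ℕ) : ZMod L))))).trace).re / (R' : ℝ) ^ 4) → Summit.HubbardSuperconductivity.HubbardSuperconductivity.Theses.FunctionFieldCertificate.MesoscopicPairOrder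 :=
  mesoscopicPairOrder_of_sharpBoxOrder

end Summit.HubbardSuperconductivity.HubbardSuperconductivity.Theorems.FunctionFieldCertificate
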